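import Summits.ValiantsHypothesis.ValiantsHypothesis.Theorems.LacunarySymmetroidMatrixDescartesDoorA26WallBubblingExpInterpolation

/-!
# `DoorA26` / line `wall_bubbling` — the Q-LIFT (general first-order shift), TOTAL POSITIVITY of the real-exponent kernel, and the SIGN-WORD LEMMA

HONEST FRAMING.  Object-search cell `pub-symmetroid`, crux `Theses.LacunarySymmetroid.DoorA26` (stmt-ValiantsHypothesis-19979; OPEN, typed,
never asserted).  W2 seat val-sym-door-p1 g18; def-free helper for obligation (R) of `Cruxes/DoorA26/Lines/wall_bubbling.lean`, continuing
#43 `…WallBubblingTouchLift` (trace shift), #44 `…WallBubblingTouchLiftPhi` (φ-lift, `c` data) and #45 `…WallBubblingExpInterpolation`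
(φ-lift with `c` discharged for ≤ 6 designated abscissae).

§1 THE Q-LIFT (`mem_twentyLocus_of_touches_alternations_pencilShift`).  The full first-order statement behind #43/#44: shift the letters by ANY
symmetric pencil on the same exponents, `S_l ↦ S_l + η T_l`, `Q(t) = Σ_l e^{δ_l t} T_l`; for `2 × 2` matrices
`det(P + ηQ) = det P + η·[det(P+Q) − det P − det Q] + η² det Q` (`det_add_smul_fin_two`, the polar form of `det`).  Sign-only hypotheses at `21`
increasing log-time abscissae with alternating virtual signs `κ_j`: `0 < κ_j det P(τ_j)` off touches, `det P(τ_j) = 0 ∧ 0 < κ_j·polar(P,Q)(τ_j)` at touches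
(first order), or `det P(τ_j) = 0 ∧ polar(P,Q)(τ_j) = 0 ∧ 0 < κ_j det Q(τ_j)` (second order — the case of a rank-ZERO zero `P(τ_j) = 0`, where every polar
form vanishes) ⇒ `δ ∈ Bubbling.TwentyLocus` (`exists_pencilShift_signs` picks `η`).  #44 is the case `T_l = c_l·1` (`polar(P, φ·1) = φ·tr P`).

§2 TOTAL POSITIVITY OF THE REAL-EXPONENT KERNEL.  `det_exp_ne_zero`: for pairwise distinct real exponents `δ_l` and pairwise distinct real nodes
`v_m`, `det (e^{δ_l v_m})_{l,m} ≠ 0` (a kernel vector would be a `n`-term exponential sum with `n` zeros: Laguerre's count `Census.RealExp.expSum_zero_or_ncard_le`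
+ #45's linear independence `expSum_coeff_eq_zero`).  `prod_mul_det_exp_cons_pos`: with the FREE node `t` in column `0` and increasing nodes `u` after it,
`0 < (∏_i (u_i − t)) · det[E(t) | E(u_0) | ⋯ | E(u_{q−1})]` for increasing exponents — proof by a HOMOTOPY of the exponents to `(0, 1, …, q)` (the
determinant never vanishes along it, so its sign is that of the Vandermonde end, Mathlib's `Matrix.det_vandermonde`, where every factor pairs with a factor
of `∏ (u_i − t)` of the same sign).  Corollary `det_exp_pos`: `0 < det (e^{δ_l v_m})` for increasing `δ` and `v` — the real-exponent companion of the tree's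
`Literature.Analysis.TotalPositivity.det_pow_strictMono_pos` (natural exponents).

§3 THE SIGN-WORD LEMMA (`exists_expSum_signWord`).  `K` increasing real exponents, `q < K` increasing change points `u` ⇒ some `φ ∈ span{e^{δ_l t}}` has
`0 < (∏_i (u_i − t))·φ(t)` at EVERY real `t ∉ u` (Laplace expansion of §2 along the free column; unused exponents get coefficient `0`): any sign word with
at most `K − 1` sign changes along any number of nodes is realised — the exact Chebyshev budget (a `K`-term sum has ≤ `K − 1` zeros, so ≥ `K` changes are
impossible).

§4 `mem_twentyLocus_of_touches_alternations_signWord`: #44's φ-lift with `c` DISCHARGED for ANY number of rank-one touches (`det P = 0 ≠ tr P`) whose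
required push word is cut out by `q ≤ 5` change points `u`: at a touch abscissa `τ_j ∉ u` the hypothesis is `0 < ε κ_j (∏_i (u_i − τ_j)) tr P(τ_j)` for
one global `ε ∈ ℝ`.  READING for (R): of the multiplicity residual after #42b/#43–#45 this closes «mixed profiles with > 6 touches and ≤ 5 push-sign
changes»; profiles needing ≥ 6 changes are not scalar-liftable and go to the Q-lift of §1 (liftable iff SOME same-support pencil `Q` realises the push
signs; the obstruction is an LP-dual balance of the touch functionals), and rank-ZERO double zeros go to its second-order clause.  Nothing here bears on `DoorA26`, `DoorA34`, (W)/(M)/(R),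
`MatrixDescartes` (18050) or `VP ≠ VNP`; registers unchanged.

[folklore] polar form of the `2 × 2` determinant; total positivity of `e^{δ v}` (Pólya–Szegő, *Aufgaben* V Abschn. 1 §5; Karlin, *Total Positivity* I,
Ch. 3 §1; the tree's ℕ-exponent version cites Gantmacher Vol. 2 XIII §8 Ex. 1); sign interpolation by a Chebyshev system.  [this work] the packaging.
-/

-- `Summit.ValiantsHypothesis.ValiantsHypothesis.…` repeats a component by the D-0017 layout
-- (single-conjunct summit), which the `dupNamespace` linter flags; the name is mandated.
set_option linter.dupNamespace false

namespace Summit.ValiantsHypothesis.ValiantsHypothesis.Theorems.LacunarySymmetroidMatrixDescartes.WallBubbling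

open Finset Filter Topology
open Bubbling (TwentyLocus)
open Census.RealExp (ncard_rpow_eq_ncard_exp expSum_zero_or_ncard_le exists_zero_of_mul_neg)

/-! ## §1 The Q-lift: shifting the letters by an arbitrary same-support symmetric pencil -/

/-- **Polar form of the `2 × 2` determinant**: `det(M + ηN) = det M + η·(det(M+N) − det M − det N) + η² det N`. [folklore] -/
theorem det_add_smul_fin_two (M N : Matrix (Fin 2) (Fin 2) ℝ) (η : ℝ) :
    (M + η • N).det = M.det + η * ((M + N).det - M.det - N.det) + η ^ 2 * N.det := by
  simp only [Matrix.det_fin_two, Matrix.add_apply, Matrix.smul_apply, smul_eq_mul]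
  ring

/-- The pencil of the shifted letters `S_l + η T_l` is `P + η Q`. [folklore] -/
theorem expPencil_pencilShift (δ : Fin 6 → ℝ) (S T : Fin 6 → Matrix (Fin 2) (Fin 2) ℝ) (η t : ℝ) :
    (∑ l, Real.exp (δ l * t) • (S l + η • T l))
      = (∑ l, Real.exp (δ l * t) • S l) + η • (∑ l, Real.exp (δ l * t) • T l) := by
  simp only [smul_add, Finset.sum_add_distrib, Finset.smul_sum]
  congr 1
  refine Finset.sum_congr rfl fun l _ => ?_
  rw [smul_comm]

/-- **Sign bookkeeping of a general shift.**  Abscissae with virtual signs `κ_j`: `0 < κ_j D_j` (nothing to decide), or `D_j = 0`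
and `0 < κ_j B_j` (first order), or `D_j = B_j = 0` and `0 < κ_j C_j` (second order).  Then for some `η > 0` every shifted value `D_j + η B_j + η² C_j`
has the sign of `κ_j`. [folklore] -/
theorem exists_pencilShift_signs {N : ℕ} (D B C κ : Fin N → ℝ)
    (hκ : ∀ j, 0 < κ j * D j ∨ (D j = 0 ∧ 0 < κ j * B j) ∨ (D j = 0 ∧ B j = 0 ∧ 0 < κ j * C j)) :
    ∃ η : ℝ, 0 < η ∧ ∀ j, 0 < κ j * (D j + η * B j + η ^ 2 * C j) := by
  have hev : ∀ j, ∀ᶠ η in 𝓝[>] (0 : ℝ), 0 < κ j * (D j + η * B j + η ^ 2 * C j) := by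
    intro j
    rcases hκ j with hD | ⟨hD, hk⟩ | ⟨hD, hB, hk⟩
    · -- non-touch: continuity at `η = 0`
      have hcont : Continuous fun η : ℝ => κ j * (D j + η * B j + η ^ 2 * C j) := by fun_prop
      have h0 : (0 : ℝ) < κ j * (D j + 0 * B j + 0 ^ 2 * C j) := by simpa using hD
      exact ((hcont.tendsto 0).eventually_const_lt h0).filter_mono nhdsWithin_le_nhds
    · -- touch: `κ (η B + η² C) = η (κ B + η κ C)`, and `κ B > 0` dominates for small `η`
      have hcont : Continuous fun η : ℝ => κ j * B j + η * (κ j * C j) := by fun_prop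
      have h0 : (0 : ℝ) < κ j * B j + 0 * (κ j * C j) := by simpa using hk
      have h1 : ∀ᶠ η in 𝓝[>] (0 : ℝ), 0 < κ j * B j + η * (κ j * C j) :=
        ((hcont.tendsto 0).eventually_const_lt h0).filter_mono nhdsWithin_le_nhds
      have h2 : ∀ᶠ η in 𝓝[>] (0 : ℝ), 0 < η := eventually_mem_nhdsWithin
      filter_upwards [h1, h2] with η hη hη0
      rw [hD]
      have : κ j * (0 + η * B j + η ^ 2 * C j) = η * (κ j * B j + η * (κ j * C j)) := by ring
      rw [this]
      exact mul_pos hη0 hη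
    · -- second-order abscissa (e.g. a rank-zero zero): the value is `η² κ C > 0` for every `η > 0`
      have h2 : ∀ᶠ η in 𝓝[>] (0 : ℝ), 0 < η := eventually_mem_nhdsWithin
      filter_upwards [h2] with η hη0
      rw [hD, hB]
      have : κ j * (0 + η * 0 + η ^ 2 * C j) = η ^ 2 * (κ j * C j) := by ring
      rw [this]
      exact mul_pos (by positivity) hk
  have hall : ∀ᶠ η in 𝓝[>] (0 : ℝ), 0 < η ∧ ∀ j, 0 < κ j * (D j + η * B j + η ^ 2 * C j) :=
    (eventually_mem_nhdsWithin).and (Filter.eventually_all.2 hev)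
  obtain ⟨η, hη0, hη⟩ := hall.exists
  exact ⟨η, hη0, hη⟩

/-- **THE Q-LIFT (general first-order shift).**  Real exponents `δ`, symmetric letters `S_l`, symmetric SHIFT letters `T_l` (the pencil
`Q(t) = Σ_l e^{δ_l t} T_l`), `21` strictly increasing log-time abscissae `τ` with virtual signs `κ`: at a non-touch abscissa `0 < κ_j det P(τ_j)`; at a touch
abscissa `det P(τ_j) = 0` and `0 < κ_j · [det(P+Q) − det P − det Q](τ_j)` (the polar form, i.e. the first-order push of `det` along `Q`), or — SECOND
ORDER, e.g. at a rank-ZERO zero `P(τ_j) = 0`, where the polar form vanishes for every `Q` — `det P(τ_j) = 0`, polar `= 0` and `0 < κ_j det Q(τ_j)`;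
`κ` strictly alternating.  Then `δ ∈ TwentyLocus`, witnessed by the letters `S_l + η T_l` for a small `η > 0`. [this work] -/
theorem mem_twentyLocus_of_touches_alternations_pencilShift (δ : Fin 6 → ℝ) (S T : Fin 6 → Matrix (Fin 2) (Fin 2) ℝ)
    (hS : ∀ l, (S l).IsSymm) (hT : ∀ l, (T l).IsSymm) (τ : Fin 21 → ℝ) (hτ : StrictMono τ) (κ : Fin 21 → ℝ)
    (hκ : ∀ j, 0 < κ j * (∑ l, Real.exp (δ l * τ j) • S l).det ∨
      ((∑ l, Real.exp (δ l * τ j) • S l).det = 0 ∧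
        0 < κ j * (((∑ l, Real.exp (δ l * τ j) • S l) + (∑ l, Real.exp (δ l * τ j) • T l)).det
              - (∑ l, Real.exp (δ l * τ j) • S l).det - (∑ l, Real.exp (δ l * τ j) • T l).det)) ∨
      ((∑ l, Real.exp (δ l * τ j) • S l).det = 0 ∧
        ((∑ l, Real.exp (δ l * τ j) • S l) + (∑ l, Real.exp (δ l * τ j) • T l)).det
              - (∑ l, Real.exp (δ l * τ j) • S l).det - (∑ l, Real.exp (δ l * τ j) • T l).det = 0 ∧
        0 < κ j * (∑ l, Real.exp (δ l * τ j) • T l).det))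
    (halt : ∀ j : Fin 20, κ j.castSucc * κ j.succ < 0) :
    δ ∈ TwentyLocus := by
  obtain ⟨η, -, hη⟩ := exists_pencilShift_signs
    (fun j => (∑ l, Real.exp (δ l * τ j) • S l).det)
    (fun j => ((∑ l, Real.exp (δ l * τ j) • S l) + (∑ l, Real.exp (δ l * τ j) • T l)).det
              - (∑ l, Real.exp (δ l * τ j) • S l).det - (∑ l, Real.exp (δ l * τ j) • T l).det)
    (fun j => (∑ l, Real.exp (δ l * τ j) • T l).det) κ hκ
  set S' : Fin 6 → Matrix (Fin 2) (Fin 2) ℝ := fun l => S l + η • T l with hS'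
  have hval : ∀ t, (∑ l, Real.exp (δ l * t) • S' l).det
      = (∑ l, Real.exp (δ l * t) • S l).det
        + η * (((∑ l, Real.exp (δ l * t) • S l) + (∑ l, Real.exp (δ l * t) • T l)).det
              - (∑ l, Real.exp (δ l * t) • S l).det - (∑ l, Real.exp (δ l * t) • T l).det)
        + η ^ 2 * (∑ l, Real.exp (δ l * t) • T l).det := by
    intro t
    rw [hS', expPencil_pencilShift, det_add_smul_fin_two]
  have halt' : ∀ j : Fin 20,
      (∑ l, Real.exp (δ l * τ j.castSucc) • S' l).det * (∑ l, Real.exp (δ l * τ j.succ) • S' l).det < 0 := by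
    intro j
    rw [hval, hval]
    exact NullEnd.neg_of_sign_transfer (hη j.castSucc) (hη j.succ) (halt j)
  refine ⟨S', fun l => (hS l).add ((hT l).smul η), ?_⟩
  rw [ncard_rpow_eq_ncard_exp]
  exact (le_ncard_of_alternations_exp δ S' (by norm_num) τ hτ halt').2

/-! ## §2 Total positivity of the real-exponent kernel `e^{δ v}` -/

/-- **Non-vanishing of the real-exponent generalized Vandermonde determinant**: for pairwise distinct real exponents `δ_l` and pairwise distinct real
nodes `v_m`, `det (e^{δ_l v_m})_{l,m} ≠ 0` — a kernel vector would give an `n`-term exponential sum with `n` zeros (Laguerre). [folklore] -/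
theorem det_exp_ne_zero {n : ℕ} (δ v : Fin n → ℝ) (hδ : Function.Injective δ) (hv : Function.Injective v) :
    (Matrix.of fun l m => Real.exp (δ l * v m)).det ≠ 0 := by
  classical
  intro hdet
  obtain ⟨a, ha, hav⟩ := Matrix.exists_vecMul_eq_zero_iff.2 hdet
  -- `a = 0` is forced, first of all when `n = 0`
  rcases Nat.eq_zero_or_pos n with h0 | hnpos
  · subst h0; exact ha (funext fun l => Fin.elim0 l)
  -- the exponential sum with coefficients `a` vanishes at the `n` distinct nodes
  have hzero : ∀ m, ∑ l, a l * Real.exp (δ l * v m) = 0 := by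
    intro m
    have := congrFun hav m
    simpa [Matrix.vecMul, dotProduct] using this
  rcases expSum_zero_or_ncard_le a δ with hall | ⟨hfin, hle⟩
  · exact ha (expSum_coeff_eq_zero n δ hδ a hall)
  · have hsub : Set.range v ⊆ {x | ∑ l, a l * Real.exp (δ l * x) = 0} := by
      rintro x ⟨m, rfl⟩; exact hzero m
    have hn : (Set.range v).ncard = n := by
      rw [Set.ncard_range_of_injective hv, Nat.card_eq_fintype_card, Fintype.card_fin]
    have h1 : n ≤ (univ.image δ).card - 1 := by
      calc n = (Set.range v).ncard := hn.symm
        _ ≤ _ := Set.ncard_le_ncard hsub hfin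
        _ ≤ _ := hle
    have h2 : (univ.image δ).card ≤ n := by
      calc (univ.image δ).card ≤ (univ : Finset (Fin n)).card := Finset.card_image_le
        _ = n := Finset.card_fin n
    omega

/-- **Signed positivity with one free node.**  Increasing exponents `δ : Fin (q+1) → ℝ`, increasing nodes `u : Fin q → ℝ`, a free node `t ∉ u` placed in
column `0`: `0 < (∏_i (u_i − t)) · det[E(t) | E(u_0) | ⋯ | E(u_{q−1})]`, `E(v) = (e^{δ_l v})_l`.  (Homotopy of the exponents to `(0,1,…,q)`, where the
determinant is Vandermonde in the `e^{v_m}`.) [folklore] -/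
theorem prod_mul_det_exp_cons_pos {q : ℕ} (δ : Fin (q + 1) → ℝ) (hδ : StrictMono δ) (u : Fin q → ℝ)
    (hu : StrictMono u) (t : ℝ) (ht : ∀ i, t ≠ u i) :
    0 < (∏ i, (u i - t)) * (Matrix.of fun l m => Real.exp (δ l * (Fin.cons t u : Fin (q + 1) → ℝ) m)).det := by
  classical
  set v : Fin (q + 1) → ℝ := Fin.cons t u with hv
  have hvinj : Function.Injective v := by
    rw [hv, Fin.cons_injective_iff]
    exact ⟨by rintro ⟨i, hi⟩; exact ht i hi.symm, hu.injective⟩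
  -- homotopy of the exponents
  set γ : ℝ → Fin (q + 1) → ℝ := fun s l => (1 - s) * δ l + s * (l : ℝ) with hγ
  have hγinj : ∀ s ∈ Set.Icc (0:ℝ) 1, Function.Injective (γ s) := by
    intro s hs
    apply StrictMono.injective
    intro a b hab
    have h1 : δ a < δ b := hδ hab
    have h2 : (a : ℝ) < (b : ℝ) := by exact_mod_cast hab
    rcases hs with ⟨hs0, hs1⟩
    show (1 - s) * δ a + s * (a : ℝ) < (1 - s) * δ b + s * (b : ℝ)
    rcases eq_or_lt_of_le hs1 with rfl | hs1'
    · simp only [sub_self, zero_mul, one_mul, zero_add]; exact h2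
    · have : 0 < 1 - s := by linarith
      nlinarith
  set F : ℝ → ℝ := fun s => (Matrix.of fun l m => Real.exp (γ s l * v m)).det with hF
  have hFne : ∀ s ∈ Set.Icc (0:ℝ) 1, F s ≠ 0 := fun s hs => det_exp_ne_zero (γ s) v (hγinj s hs) hvinj
  have hFcont : Continuous F := by
    refine Continuous.matrix_det ?_
    refine continuous_matrix fun l m => ?_
    simp only [Matrix.of_apply, hγ]
    fun_prop
  have hF0 : F 0 = (Matrix.of fun l m => Real.exp (δ l * v m)).det := by
    simp [hF, hγ]
  have hF1 : F 1 = ∏ i : Fin (q + 1), ∏ j ∈ Ioi i, (Real.exp (v j) - Real.exp (v i)) := by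
    have hmat : (Matrix.of fun l m => Real.exp (γ 1 l * v m))
        = (Matrix.vandermonde fun m => Real.exp (v m)).transpose := by
      ext l m
      simp only [hγ, Matrix.of_apply, Matrix.transpose_apply, Matrix.vandermonde_apply, sub_self, zero_mul, one_mul,
        zero_add]
      rw [Real.exp_nat_mul]
    simp only [hF, hmat, Matrix.det_transpose, Matrix.det_vandermonde]
  -- the Vandermonde end, split off column `0`
  have hsplit : (∏ i : Fin (q + 1), ∏ j ∈ Ioi i, (Real.exp (v j) - Real.exp (v i)))
      = (∏ i : Fin q, (Real.exp (u i) - Real.exp t)) * ∏ i : Fin q, ∏ j ∈ Ioi i, (Real.exp (u j) - Real.exp (u i)) := by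
    rw [Fin.prod_univ_succ, Fin.prod_Ioi_zero]
    congr 1
    refine Finset.prod_congr rfl fun i _ => ?_
    rw [Fin.prod_Ioi_succ]
    simp [hv]
  have hpos1 : 0 < (∏ i, (u i - t)) * F 1 := by
    rw [hF1, hsplit, ← mul_assoc, ← Finset.prod_mul_distrib]
    apply mul_pos
    · apply Finset.prod_pos
      intro i _
      rcases lt_or_gt_of_ne (ht i) with h | h
      · exact mul_pos (by linarith) (by linarith [Real.exp_lt_exp.2 h])
      · exact mul_pos_of_neg_of_neg (by linarith) (by linarith [Real.exp_lt_exp.2 h])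
    · apply Finset.prod_pos
      intro i _
      apply Finset.prod_pos
      intro j hj
      have hij : i < j := Finset.mem_Ioi.1 hj
      linarith [Real.exp_lt_exp.2 (hu hij)]
  -- `F 0` and `F 1` have the same sign (no zero in between)
  have hsame : 0 < F 0 * F 1 := by
    rcases lt_trichotomy (F 0 * F 1) 0 with h | h | h
    · exfalso
      obtain ⟨z, hz, hz0⟩ := exists_zero_of_mul_neg (f := F) zero_lt_one hFcont.continuousOn h
      exact hFne z ⟨hz.1.le, hz.2.le⟩ hz0
    · exfalso
      rcases mul_eq_zero.1 h with h0 | h1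
      · exact hFne 0 ⟨le_refl _, zero_le_one⟩ h0
      · exact hFne 1 ⟨zero_le_one, le_refl _⟩ h1
    · exact h
  rw [← hF0]
  have hF1sq : 0 < F 1 * F 1 := mul_self_pos.2 (hFne 1 ⟨zero_le_one, le_refl _⟩)
  have h3 : 0 < ((∏ i, (u i - t)) * F 1) * (F 0 * F 1) := mul_pos hpos1 hsame
  have h4 : ((∏ i, (u i - t)) * F 1) * (F 0 * F 1) = ((∏ i, (u i - t)) * F 0) * (F 1 * F 1) := by ring
  rw [h4] at h3
  exact (mul_pos_iff_of_pos_right hF1sq).1 h3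

/-- **TOTAL POSITIVITY OF THE REAL-EXPONENT KERNEL**: for strictly increasing real exponents `δ` and strictly increasing real nodes `v`,
`0 < det (e^{δ_l v_m})_{l,m}`.  (Real-exponent companion of `Literature.Analysis.TotalPositivity.det_pow_strictMono_pos`.) [folklore] -/
theorem det_exp_pos {n : ℕ} (δ v : Fin n → ℝ) (hδ : StrictMono δ) (hv : StrictMono v) :
    0 < (Matrix.of fun l m => Real.exp (δ l * v m)).det := by
  rcases Nat.eq_zero_or_pos n with h0 | hn
  · subst h0; simp [Matrix.det_isEmpty]
  · obtain ⟨q, rfl⟩ : ∃ q, n = q + 1 := ⟨n - 1, by omega⟩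
    have htail : StrictMono (Fin.tail v) := fun a b hab => hv (Fin.succ_lt_succ_iff.2 hab)
    have hne : ∀ i, v 0 ≠ Fin.tail v i := fun i => (hv (Fin.succ_pos i)).ne
    have h := prod_mul_det_exp_cons_pos δ hδ (Fin.tail v) htail (v 0) hne
    rw [Fin.cons_self_tail] at h
    have hprod : 0 < ∏ i, (Fin.tail v i - v 0) :=
      Finset.prod_pos fun i _ => sub_pos.2 (hv (Fin.succ_pos i))
    exact (mul_pos_iff_of_pos_left hprod).1 h

/-! ## §3 The sign-word lemma -/

/-- **Sign word, `q + 1` exponents.**  Increasing exponents `δ : Fin (q+1) → ℝ` and increasing change points `u : Fin q → ℝ` ⇒ some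
`φ(t) = Σ_l c_l e^{δ_l t}` has `0 < (∏_i (u_i − t))·φ(t)` for every real `t ∉ u` (Laplace expansion of `prod_mul_det_exp_cons_pos` along the free column).
[folklore] -/
theorem exists_expSum_signWord_cons {q : ℕ} (δ : Fin (q + 1) → ℝ) (hδ : StrictMono δ) (u : Fin q → ℝ) (hu : StrictMono u) :
    ∃ c : Fin (q + 1) → ℝ, ∀ t, (∀ i, t ≠ u i) → 0 < (∏ i, (u i - t)) * ∑ l, c l * Real.exp (δ l * t) := by
  classical
  refine ⟨fun l => (-1) ^ (l : ℕ) * (Matrix.of fun (l' : Fin q) (m : Fin q) => Real.exp (δ (l.succAbove l') * u m)).det, ?_⟩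
  intro t ht
  have h := prod_mul_det_exp_cons_pos δ hδ u hu t ht
  rw [Matrix.det_succ_column_zero] at h
  have hsub : ∀ i : Fin (q + 1),
      (Matrix.of fun l m => Real.exp (δ l * (Fin.cons t u : Fin (q + 1) → ℝ) m)).submatrix i.succAbove Fin.succ
        = Matrix.of fun (l' : Fin q) (m : Fin q) => Real.exp (δ (i.succAbove l') * u m) := by
    intro i; ext l' m; simp [Matrix.submatrix_apply, Fin.cons_succ]
  simp only [hsub, Matrix.of_apply, Fin.cons_zero] at h
  convert h using 2
  refine Finset.sum_congr rfl fun l _ => ?_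
  ring

/-- **THE SIGN-WORD LEMMA.**  `K` strictly increasing real exponents `δ`, `q < K` strictly increasing change points `u`: some `φ ∈ span{e^{δ_l t}}` satisfies
`0 < (∏_i (u_i − t))·φ(t)` at EVERY real `t ∉ u` — so any sign word with at most `K − 1` changes along any finite (or infinite) set of nodes is realised
by the `K`-term system. [folklore] -/
theorem exists_expSum_signWord {K q : ℕ} (δ : Fin K → ℝ) (hδ : StrictMono δ) (hq : q < K) (u : Fin q → ℝ) (hu : StrictMono u) :
    ∃ c : Fin K → ℝ, ∀ t, (∀ i, t ≠ u i) → 0 < (∏ i, (u i - t)) * ∑ l, c l * Real.exp (δ l * t) := by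
  classical
  have hle : q + 1 ≤ K := hq
  set ι : Fin (q + 1) → Fin K := Fin.castLE hle with hι
  obtain ⟨c', hc'⟩ := exists_expSum_signWord_cons (δ ∘ ι) (hδ.comp (Fin.strictMono_castLE hle)) u hu
  refine ⟨fun l => ∑ l', if ι l' = l then c' l' else 0, fun t ht => ?_⟩
  have hsum : (∑ l, (∑ l', if ι l' = l then c' l' else 0) * Real.exp (δ l * t))
      = ∑ l', c' l' * Real.exp ((δ ∘ ι) l' * t) := by
    simp_rw [Finset.sum_mul]
    rw [Finset.sum_comm]
    refine Finset.sum_congr rfl fun l' _ => ?_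
    simp_rw [ite_mul, zero_mul]
    rw [Finset.sum_ite_eq]
    simp
  rw [hsum]
  exact hc' t ht

/-! ## §4 The φ-lift for any number of touches with a push word of at most five changes -/

/-- **THE φ-LIFT WITH THE COEFFICIENTS DISCHARGED BY A SIGN WORD.**  Strictly increasing real exponents `δ`, symmetric letters, `21` increasing
log-time abscissae `τ` with sign-only alternation data `κ`, `q ≤ 5` increasing change points `u` and one global `ε ∈ ℝ`; every abscissa is a non-touch
(`0 < κ_j det P(τ_j)`) or a touch off the change points (`det P(τ_j) = 0`, `τ_j ∉ u`) at which `0 < ε κ_j (∏_i (u_i − τ_j)) tr P(τ_j)` — i.e. the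
required push word along the touches is cut out by `u`.  Then `δ ∈ TwentyLocus` (any number of touches). [this work] -/
theorem mem_twentyLocus_of_touches_alternations_signWord (δ : Fin 6 → ℝ) (hd : StrictMono δ) (S : Fin 6 → Matrix (Fin 2) (Fin 2) ℝ)
    (hS : ∀ l, (S l).IsSymm) (τ : Fin 21 → ℝ) (hτ : StrictMono τ) (κ : Fin 21 → ℝ) {q : ℕ} (hq : q < 6) (u : Fin q → ℝ)
    (hu : StrictMono u) (ε : ℝ)
    (hκ : ∀ j, 0 < κ j * (∑ l, Real.exp (δ l * τ j) • S l).det ∨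
      ((∑ l, Real.exp (δ l * τ j) • S l).det = 0 ∧ (∀ i, τ j ≠ u i) ∧
        0 < ε * κ j * (∏ i, (u i - τ j)) * (∑ l, Real.exp (δ l * τ j) • S l).trace))
    (halt : ∀ j : Fin 20, κ j.castSucc * κ j.succ < 0) :
    δ ∈ TwentyLocus := by
  obtain ⟨c, hc⟩ := exists_expSum_signWord δ hd hq u hu
  refine mem_twentyLocus_of_touches_alternations_phi δ S hS τ hτ κ (fun l => ε * c l) ?_ halt
  intro j
  rcases hκ j with h | ⟨hD, hne, hk⟩
  · exact Or.inl h
  · refine Or.inr ⟨hD, ?_⟩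
    have hφ := hc (τ j) hne
    have hsum : (∑ l, ε * c l * Real.exp (δ l * τ j)) = ε * ∑ l, c l * Real.exp (δ l * τ j) := by
      rw [Finset.mul_sum]
      refine Finset.sum_congr rfl fun l _ => ?_
      ring
    rw [hsum]
    have hprod := mul_pos hk hφ
    have hP2 : 0 < (∏ i, (u i - τ j)) ^ 2 := by
      have : (∏ i, (u i - τ j)) ≠ 0 := Finset.prod_ne_zero_iff.2 fun i _ => sub_ne_zero.2 (hne i).symm
      positivity
    have hre : ε * κ j * (∏ i, (u i - τ j)) * (∑ l, Real.exp (δ l * τ j) • S l).trace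
          * ((∏ i, (u i - τ j)) * ∑ l, c l * Real.exp (δ l * τ j))
        = κ j * (ε * ∑ l, c l * Real.exp (δ l * τ j)) * (∑ l, Real.exp (δ l * τ j) • S l).trace
          * (∏ i, (u i - τ j)) ^ 2 := by ring
    rw [hre] at hprod
    exact (mul_pos_iff_of_pos_right hP2).1 hprod

end Summit.ValiantsHypothesis.ValiantsHypothesis.Theorems.LacunarySymmetroidMatrixDescartes.WallBubbling
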